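import Mathlib
import Summits.MatrixMultiplication.MatrixMultiplication.Theses.FourierTwoFamiliesModP
import Summits.MatrixMultiplication.MatrixMultiplication.Theorems.PrimeTwoFamilies.Negative.Slices
import Literature.Computability.AlgebraicComplexity.SimultaneousDoubleProduct

/-!
# Packing-tightness at every scale gives every slice of the crux (support file)

Item `stmt-MatrixMultiplication-14308` (`FourierTwoFamiliesModP.PrimeTwoFamilies`, CKSU 2005 Conj. 4.7 with
prime cyclic hosts), line `Sketch` (cycle c1, capacity-gadget skeleton `Cruxes/PrimeTwoFamilies/Lines/Sketch.lean`),
registered stub `stub_cruxOfPackingTight`.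

"Packing-tight at every scale" means: for every `γ ∈ (0,1)` and every `ε > 0` there are arbitrarily
large primes `p` carrying a family of SDPP pairs `(A_i, B_i)` in `ℤ/p` ((W): every `A_i ⊕ B_i` direct;
(X): cross sums separate the outer indices) with all co-volumes `|A_i||B_i| ≥ p ^ γ` and at least
`p ^ (1 - γ/2 - ε)` pairs.  We show this gives every slice `δ > 0` of the crux
(`PrimeTwoFamiliesAt δ`: `n ≥ n₀` pairs in `ℤ/p`, `p ≤ n ^ (2+δ)`, co-volumes `≥ n ^ (2-δ)`).

Proof.  By slice monotonicity (`PrimeTwoFamiliesAt.mono`) it suffices to treat `0 < δ ≤ 1`.  Take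
`γ := 1 - δ/8` and `ε := δ/16`, so that `1 - γ/2 - ε = 1/2` exactly, and a prime
`p ≥ max (n₀²) P₁` with a packing-tight family of `N ≥ √p` pairs.  Keep the first `n := ⌈√p⌉₊ ≤ N`
pairs (both (W) and (X) restrict along the injection `Fin.castLE`).  Then `n ≥ n₀` because `p ≥ n₀²`;
`p = (√p)² ≤ n² ≤ n ^ (2+δ)`; and `n ≤ √p + 1 ≤ 2√p` gives
`n ^ (2-δ) ≤ 2 ^ (2-δ) · p ^ (1-δ/2) ≤ 4 · p ^ (1-δ/2) ≤ p ^ (1-δ/8) = p ^ γ ≤ |A_i||B_i|`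
as soon as `p ≥ P₁`, the threshold of the elementary domination `4 · p ^ (1-δ/2) ≤ p ^ (1-δ/8)`
(`eventually_dominates`, exponent gap `3δ/8 > 0`).
-/

-- single-conjunct summit: the mandated namespace repeats `MatrixMultiplication` (summit = sub-problem).
set_option linter.dupNamespace false

namespace Summit.MatrixMultiplication.MatrixMultiplication.Theorems.PrimeTwoFamilies.CapacityLift

open Finset
open Summit.MatrixMultiplication.MatrixMultiplication.Theses
open Summit.MatrixMultiplication.MatrixMultiplication.Theorems.PrimeTwoFamilies.Negative
open Literature.Computability.AlgebraicComplexity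

/-- A constant multiple of a smaller real power of `m` is eventually dominated by a larger power:
if `0 < K` and `a < b` then `K * m ^ a ≤ m ^ b` for all naturals `m ≥ ⌈K ^ (1/(b-a))⌉₊ + 1`. -/
private theorem eventually_dominates (K a b : ℝ) (hK : 0 < K) (hab : a < b) :
    ∃ m₀ : ℕ, ∀ m : ℕ, m₀ ≤ m → K * (m : ℝ) ^ a ≤ (m : ℝ) ^ b := by
  -- adapted from `LadderLift.eventually_dominates` (StubBookkeeping, private there)
  have hc : 0 < b - a := sub_pos.mpr hab
  refine ⟨⌈K ^ (b - a)⁻¹⌉₊ + 1, fun m hm => ?_⟩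
  have hm1 : ((⌈K ^ (b - a)⁻¹⌉₊ + 1 : ℕ) : ℝ) ≤ m := by exact_mod_cast hm
  push_cast at hm1
  have hceil : K ^ (b - a)⁻¹ ≤ (⌈K ^ (b - a)⁻¹⌉₊ : ℝ) := Nat.le_ceil _
  have hT0 : (0 : ℝ) ≤ K ^ (b - a)⁻¹ := Real.rpow_nonneg hK.le _
  have hKm' : K ^ (b - a)⁻¹ ≤ (m : ℝ) := by linarith
  have hm0 : (0 : ℝ) < m := by linarith
  have hKm : K ≤ (m : ℝ) ^ (b - a) := by
    calc K = (K ^ (b - a)⁻¹) ^ (b - a) := (Real.rpow_inv_rpow hK.le hc.ne').symm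
      _ ≤ (m : ℝ) ^ (b - a) := Real.rpow_le_rpow hT0 hKm' hc.le
  calc K * (m : ℝ) ^ a ≤ (m : ℝ) ^ (b - a) * (m : ℝ) ^ a :=
        mul_le_mul_of_nonneg_right hKm (Real.rpow_nonneg hm0.le _)
    _ = (m : ℝ) ^ b := by rw [← Real.rpow_add hm0, sub_add_cancel]

/-- The slices `0 < δ ≤ 1` of the crux from packing-tightness at every scale: with `γ = 1 - δ/8`,
`ε = δ/16` (so `1 - γ/2 - ε = 1/2`) and a prime `p ≥ max (n₀²) P₁`, keep the first `n = ⌈√p⌉₊` of the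
`N ≥ √p` packing-tight pairs; then `n₀ ≤ n`, `p ≤ n² ≤ n ^ (2+δ)` and
`n ^ (2-δ) ≤ (2√p) ^ (2-δ) ≤ 4 p ^ (1-δ/2) ≤ p ^ (1-δ/8) ≤ |A_i||B_i|` for `p ≥ P₁`. -/
private theorem primeTwoFamiliesAt_of_packingTight_le_one
    (h : ∀ γ : ℝ, 0 < γ → γ < 1 →
      ∀ ε : ℝ, 0 < ε → ∀ p₀ : ℕ, ∃ p ≥ p₀, p.Prime ∧ ∃ (n : ℕ) (A B : Fin n → Finset (ZMod p)),
        (∀ i : Fin n, ∀ a ∈ A i, ∀ a' ∈ A i, ∀ b ∈ B i, ∀ b' ∈ B i,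
            (a - a') + (b - b') = 0 → a = a' ∧ b = b') ∧
        (∀ i j k : Fin n, ∀ a ∈ A i, ∀ a' ∈ A j, ∀ b ∈ B j, ∀ b' ∈ B k,
            (a - a') + (b - b') = 0 → i = k) ∧
        (∀ i : Fin n, (p : ℝ) ^ γ ≤ (((A i).card * (B i).card : ℕ) : ℝ)) ∧
        (p : ℝ) ^ (1 - γ / 2 - ε) ≤ (n : ℝ))
    {δ : ℝ} (hδ : 0 < δ) (hδ1 : δ ≤ 1) : PrimeTwoFamiliesAt δ := by
  intro n₀
  -- threshold for `4 · p ^ (1-δ/2) ≤ p ^ (1-δ/8)`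
  obtain ⟨P₁, hP₁⟩ :=
    eventually_dominates 4 (1 - δ / 2) (1 - δ / 8) (by norm_num) (by linarith)
  -- a packing-tight level at scale `γ = 1 - δ/8` with slack `ε = δ/16`
  obtain ⟨p, hp₀, hp, N, A, B, hW, hX, hAB, hN⟩ :=
    h (1 - δ / 8) (by linarith) (by linarith) (δ / 16) (by positivity) (max (n₀ ^ 2) P₁)
  have hexp : (1 - (1 - δ / 8) / 2 - δ / 16 : ℝ) = 1 / 2 := by ring
  rw [hexp, ← Real.sqrt_eq_rpow] at hN
  have hn₀p : n₀ ^ 2 ≤ p := le_trans (le_max_left _ _) hp₀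
  have hP₁p : P₁ ≤ p := le_trans (le_max_right _ _) hp₀
  have hp1 : (1 : ℝ) ≤ p := by exact_mod_cast hp.one_lt.le
  have hp0 : (0 : ℝ) ≤ p := Nat.cast_nonneg _
  have hsqrt1 : (1 : ℝ) ≤ √(p : ℝ) := Real.one_le_sqrt.mpr hp1
  -- keep the first `n = ⌈√p⌉₊` pairs
  set n : ℕ := ⌈√(p : ℝ)⌉₊
  have hnN : n ≤ N := Nat.ceil_le.mpr hN
  have hsn : √(p : ℝ) ≤ n := Nat.le_ceil _
  have hns : (n : ℝ) < √(p : ℝ) + 1 := Nat.ceil_lt_add_one (Real.sqrt_nonneg _)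
  have hn₀n : n₀ ≤ n := by
    have h1 : (n₀ : ℝ) ≤ √(p : ℝ) := Real.le_sqrt_of_sq_le (by exact_mod_cast hn₀p)
    exact_mod_cast h1.trans hsn
  have hn1 : (1 : ℝ) ≤ n := hsqrt1.trans hsn
  have hn0 : (0 : ℝ) ≤ n := Nat.cast_nonneg _
  have hn2 : (n : ℝ) ≤ 2 * √(p : ℝ) := by linarith [hns.le]
  refine ⟨n, hn₀n, p, hp, A ∘ Fin.castLE hnN, B ∘ Fin.castLE hnN, ?_, ?_, ?_, ?_⟩
  · intro i
    exact hW (Fin.castLE hnN i)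
  · intro i j k a ha a' ha' b hb b' hb' h0
    exact Fin.castLE_injective hnN (hX _ _ _ a ha a' ha' b hb b' hb' h0)
  · calc (p : ℝ) = √(p : ℝ) ^ 2 := (Real.sq_sqrt hp0).symm
      _ ≤ (n : ℝ) ^ 2 := by gcongr
      _ = (n : ℝ) ^ (2 : ℝ) := (Real.rpow_two _).symm
      _ ≤ (n : ℝ) ^ (2 + δ) := Real.rpow_le_rpow_of_exponent_le hn1 (by linarith)
  · intro i
    refine le_trans ?_ (hAB (Fin.castLE hnN i))
    have h2δ : (0 : ℝ) ≤ 2 - δ := by linarith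
    have h4 : (2 : ℝ) ^ (2 - δ) ≤ 4 := by
      calc (2 : ℝ) ^ (2 - δ) ≤ (2 : ℝ) ^ (2 : ℝ) :=
            Real.rpow_le_rpow_of_exponent_le (by norm_num) (by linarith)
        _ = 4 := by rw [Real.rpow_two]; norm_num
    have h5 : ((p : ℝ) ^ (1 / 2 : ℝ)) ^ (2 - δ) = (p : ℝ) ^ (1 - δ / 2) := by
      rw [← Real.rpow_mul hp0]
      congr 1
      ring
    calc (n : ℝ) ^ (2 - δ) ≤ (2 * √(p : ℝ)) ^ (2 - δ) := Real.rpow_le_rpow hn0 hn2 h2δ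
      _ = (2 : ℝ) ^ (2 - δ) * ((p : ℝ) ^ (1 / 2 : ℝ)) ^ (2 - δ) := by
          rw [Real.mul_rpow (by norm_num) (Real.sqrt_nonneg _), Real.sqrt_eq_rpow]
      _ ≤ 4 * (p : ℝ) ^ (1 - δ / 2) := by
          rw [h5]
          exact mul_le_mul_of_nonneg_right h4 (Real.rpow_nonneg hp0 _)
      _ ≤ (p : ℝ) ^ (1 - δ / 8) := hP₁ p hP₁p

/-- **Stub `stub_cruxOfPackingTight`** (kill-side calibration of line `Sketch`): packing-tightness at
every scale — for all `γ ∈ (0,1)`, `ε > 0`, arbitrarily large primes `p` carry SDPP families in `ℤ/p`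
((W) every pair direct, (X) cross sums separate the outer indices) with co-volumes `≥ p ^ γ` and
`≥ p ^ (1 - γ/2 - ε)` pairs — implies every slice `δ > 0` of the crux `PrimeTwoFamilies`.  For
`0 < δ ≤ 1` this is `primeTwoFamiliesAt_of_packingTight_le_one` (`γ = 1 - δ/8`, `ε = δ/16`, keep
`⌈√p⌉₊` pairs); for `δ > 1` use the slice `δ = 1` and `PrimeTwoFamiliesAt.mono`. -/
theorem stub_cruxOfPackingTight
    (h : ∀ γ : ℝ, 0 < γ → γ < 1 →
      ∀ ε : ℝ, 0 < ε → ∀ p₀ : ℕ, ∃ p ≥ p₀, p.Prime ∧ ∃ (n : ℕ) (A B : Fin n → Finset (ZMod p)),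
        (∀ i : Fin n, ∀ a ∈ A i, ∀ a' ∈ A i, ∀ b ∈ B i, ∀ b' ∈ B i,
            (a - a') + (b - b') = 0 → a = a' ∧ b = b') ∧
        (∀ i j k : Fin n, ∀ a ∈ A i, ∀ a' ∈ A j, ∀ b ∈ B j, ∀ b' ∈ B k,
            (a - a') + (b - b') = 0 → i = k) ∧
        (∀ i : Fin n, (p : ℝ) ^ γ ≤ (((A i).card * (B i).card : ℕ) : ℝ)) ∧
        (p : ℝ) ^ (1 - γ / 2 - ε) ≤ (n : ℝ)) :
    ∀ δ : ℝ, 0 < δ → PrimeTwoFamiliesAt δ := by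
  intro δ hδ
  by_cases h1 : δ ≤ 1
  · exact primeTwoFamiliesAt_of_packingTight_le_one h hδ h1
  · exact (primeTwoFamiliesAt_of_packingTight_le_one h one_pos le_rfl).mono (not_le.mp h1).le

end Summit.MatrixMultiplication.MatrixMultiplication.Theorems.PrimeTwoFamilies.CapacityLift
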